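import Summits.PneNP.PneNP.Theorems.ClusUniversalCertificatePolylogGivesCapped

/-!
# Route ClusUniversalCertificate — `Assembly` (stmt-PneNP-19686)

`Assembly := UniversalCertAll → PairModelReduction → ClusExistsCapped`: the cruxes-to-leaf composition of route
ClusUniversalCertificate (rung F-N1, cell pnp-ideate).  `PairModelReduction` is itself the implication
`UniversalCertAll → PolyLoss`, and `PolyLoss → ClusExistsCapped` is the route's support item `PolylogGivesCapped`
(stmt-PneNP-19685), PROVED in the tree as
`Summit.PneNP.PneNP.Theorems.ClusUniversalCertificatePolylogGivesCapped.polylogGivesCapped_holds`; so the assembly is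
exactly the route's deciding theorem `ClusUniversalCertificate.closes` with its third hypothesis discharged.  Honest scope:
this closes the ASSEMBLY item only — both cruxes (`UniversalCertAll`, stmt-PneNP-19683; `PairModelReduction`,
stmt-PneNP-19684) remain open, and nothing here bears on P vs NP.  This file imports only the landed support theorem
(which imports the route file).
-/

set_option linter.dupNamespace false -- `Summit.PneNP.PneNP.…`: summit = sub-problem name (D-0017 single-conjunct layout)

namespace Summit.PneNP.PneNP.Theorems

/-- **Assembly item of route ClusUniversalCertificate (stmt-PneNP-19686)**:
`UniversalCertAll → PairModelReduction → ClusExistsCapped`, by feeding `PairModelReduction` with the certificate and the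
resulting PolyLoss statement to the proved support step `polylogGivesCapped_holds` (equivalently: the route's deciding
theorem `ClusUniversalCertificate.closes` with `h₃ := polylogGivesCapped_holds`). [folklore] -/
theorem clusUniversalCertificate_assembly_proof :
    Summit.PneNP.PneNP.Theses.ClusUniversalCertificate.Assembly := by
  unfold Summit.PneNP.PneNP.Theses.ClusUniversalCertificate.Assembly
  exact fun h₁ h₂ =>
    Summit.PneNP.PneNP.Theorems.ClusUniversalCertificatePolylogGivesCapped.polylogGivesCapped_holds (h₂ h₁)

end Summit.PneNP.PneNP.Theorems
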